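import Literature.AlgebraicGeometry.Motives.AbelianVarietyBaseChange
import Literature.AlgebraicGeometry.ComplexMultiplication.ShimuraInflationBettiJunctions
import Literature.AlgebraicGeometry.HodgeTheory.BettiUniverseAxioms
import HarnessLib

/-!
# Δ2 BRIDGE — S4∕S2 PIN PRIMITIVES: Betti pull-back along the COMPLEXIFICATION `f_ℂ = f ⊗_{E,ι₁} ℂ` of a homomorphism of abelian
# varieties over the CM field is additive and functorial in `f`

Cell pub-hodgecm2 (COR-CM), Δ2 BRIDGE (COORDINATOR «Δ2 RESTRUCTURE FOR SPEED», 2026-08-23), seat d2bridge-prove-4 (S4).  THEOREMS ONLY over the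
tree's REAL objects: `Motives.AbelianVariety.Hom.baseChange` (`Motives/AbelianVarietyBaseChange`: `baseChange_add ∕ _comp ∕ _id`,
`baseChange_zsmul_id`), additivity of `f ↦ f^*` on `H¹(−(ℂ); ℚ)` for homomorphisms of complex abelian varieties
(`ComplexMultiplication/ShimuraInflationBettiJunctions`: `bettiCohomology_map_add_one`, Eckmann–Hilton), `BettiUniverse.pull ∕ pull_comp`.
Hole-free; nothing landed is edited or restated; no `def`, no named fact.

WHY (the Δ2 contract `hcm`, [Liu2021] proof of Thm. 4.18, l. 2247–2253).  S2's record of the proof's map (4.2) at level `K` is the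
`ℚ`-linear extension to `Hom_E(A_K, A_μ)_ℚ = ℚ ⊗_ℤ Hom_E(A_K, A_μ)` of `f ↦ (f ⊗_{E,ι₁} ℂ)^*` on `H¹_B(A_μ ⊗_{E,ι₁} ℂ; ℚ)` (d2bridge-prove-2,
`CorCM/D2Bridge/OmegaLevelwisePullback.lean`, pin primitive `phiStarQ K : (A_K ⟶ A_μ) →+ (H¹(A_{μ,ℂ}) →ₗ[ℚ] H¹(A_{K,ℂ}))`, law `phiStarQ_comp`);
S4 (`CorCM/D2Bridge/HcmS4Functoriality.lean`) then moves the class along `P_Γ ↪ X_{K,ℂ} → A_{K,ℂ} → A_{μ,ℂ}` by `pull_comp`.  The extension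
EXISTS only because `f ↦ f_ℂ^*` is ADDITIVE; this file proves the three laws the pin needs, in the pin's currency `BettiUniverse.pull (−) 1`
on the `ℂ`-schemes `(A.baseChange ℂ).X`, precomposed with an arbitrary `ℂ`-morphism `j : P ⟶ (A_K ⊗ ℂ).X` (the Abel–Jacobi side):
`pull_comp_baseChange_add` («`(j ≫ (f+g)_ℂ)^* = (j ≫ f_ℂ)^* + (j ≫ g_ℂ)^*`»), `pull_comp_baseChange_zero`, `pull_comp_baseChange_comp`
(«`(j ≫ (f ≫ g)_ℂ)^* = (j ≫ f_ℂ)^* ∘ g_ℂ^*`», the shape of `phiStarQ_comp` ∕ `P_smul`), `pull_baseChange_zsmul_id` («`[n]_ℂ^* = n`»).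
HC_CM is NOT proved; «Δ2 BRIDGE CLOSED» is NOT claimed; no pointer ∕ count ∕ hM token.

## References
* [Liu2021] Y. Liu, *Fourier–Jacobi cycles and arithmetic relative trace formula*, Camb. J. Math. 9 (2021) = arXiv:2102.11518 — proof of
  Thm. 4.18 (FJcycle.tex l. 2247–2253), Def. 4.16 (l. 2219: «`M_μ` acts via `i_μ`», «acts `M_μ`-linearly via its action on `A_∞`»).
* [GortzWedhorn2020] U. Görtz, T. Wedhorn, *Algebraic Geometry I*, Remark 16.54 (base change of group schemes).
* [HatcherAT2002] A. Hatcher, *Algebraic Topology*, CUP 2002, §3.1 p. 198.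
-/

set_option autoImplicit false

noncomputable section

open scoped TensorProduct
open CategoryTheory
open Literature.AlgebraicGeometry.Motives (SchemeOver AbelianVariety bettiCohomology)
open Literature.AlgebraicGeometry.Motives.AbelianVariety (Hom.baseChange)
open Literature.AlgebraicGeometry.HodgeTheory.BettiUniverse (pull pull_comp pull_id)
open Literature.AlgebraicGeometry.ComplexMultiplication (bettiCohomology_map_add_one bettiCohomology_map_zero_one
  bettiCohomology_map_nsmul_id_one)

namespace Summit.HodgeConjecture.CorCM.D2Bridge

universe u

section ComplexHoms

variable {A B C : AbelianVariety ℂ}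

/-- `(f + g)^* = f^* + g^*` on `H¹(B(ℂ); ℚ) →ₗ[ℚ] H¹(A(ℂ); ℚ)` in the `BettiUniverse.pull` currency (the tree's `bettiCohomology_map_add_one`).
[cite: HatcherAT2002, §3.1 p. 198] -/
theorem pull_add_one (f g : A ⟶ B) :
    pull (f + g).hom.hom.hom 1 = pull f.hom.hom.hom 1 + pull g.hom.hom.hom 1 :=
  congrArg ModuleCat.Hom.hom (bettiCohomology_map_add_one f g)

/-- `0^* = 0` on `H¹(−(ℂ); ℚ)` in the `pull` currency. [folklore] -/
theorem pull_zero_one : pull (0 : A ⟶ B).hom.hom.hom 1 = 0 :=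
  congrArg ModuleCat.Hom.hom (bettiCohomology_map_zero_one (A := A) (B := B))

/-- `(f ≫ g)^* = f^* ∘ g^*` for homomorphisms of complex abelian varieties, in the `pull` currency. [cite: HatcherAT2002, §3.1 p. 198] -/
theorem pull_comp_hom (f : A ⟶ B) (g : B ⟶ C) (k : ℕ) :
    pull (f ≫ g).hom.hom.hom k = pull f.hom.hom.hom k ∘ₗ pull g.hom.hom.hom k :=
  pull_comp f.hom.hom.hom g.hom.hom.hom k

/-- `[n]^* = n` on `H¹(A(ℂ); ℚ)` (natural multiples), in the `pull` currency. [folklore] -/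
theorem pull_nsmul_id_one (n : ℕ) : pull (n • 𝟙 A : A ⟶ A).hom.hom.hom 1 = n • LinearMap.id := by
  have h := congrArg ModuleCat.Hom.hom (bettiCohomology_map_nsmul_id_one (A := A) n)
  rw [ModuleCat.hom_nsmul] at h
  exact h

end ComplexHoms

/-! ## Complexified homomorphisms of abelian varieties over the CM field `E` (`[Algebra E ℂ]` = the embedding `ι₁`) -/

section BaseChange

variable {E : Type} [Field E] [Algebra E ℂ] {AK Aμ Aν : AbelianVariety E} {P : SchemeOver ℂ}

/-- **Additivity of `f ↦ (j ≫ f_ℂ)^*` on `H¹`** — the law that makes S2's `phiStarQ` an additive map `Hom_E(A_K, A_μ) →+ Hom_ℚ(H¹(A_{μ,ℂ}), H¹(P))`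
(`j : P ⟶ A_{K,ℂ}` any `ℂ`-morphism, e.g. the Abel–Jacobi side; `f_ℂ = Hom.baseChange ℂ f`): `(j ≫ (f + g)_ℂ)^* = (j ≫ f_ℂ)^* + (j ≫ g_ℂ)^*`.
[cite: Liu2021, proof of Thm. 4.18 (l. 2247–2253)] [cite: GortzWedhorn2020, Remark 16.54] -/
theorem pull_comp_baseChange_add (j : P ⟶ (AK.baseChange ℂ).X) (f g : AK ⟶ Aμ) :
    pull (j ≫ (Hom.baseChange ℂ (f + g)).hom.hom.hom) 1 =
      pull (j ≫ (Hom.baseChange ℂ f).hom.hom.hom) 1 + pull (j ≫ (Hom.baseChange ℂ g).hom.hom.hom) 1 := by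
  rw [pull_comp, pull_comp, pull_comp, AbelianVariety.Hom.baseChange_add, pull_add_one, LinearMap.comp_add]

/-- `(j ≫ 0_ℂ)^* = 0` on `H¹`. [folklore] -/
theorem pull_comp_baseChange_zero (j : P ⟶ (AK.baseChange ℂ).X) :
    pull (j ≫ (Hom.baseChange ℂ (0 : AK ⟶ Aμ)).hom.hom.hom) 1 = 0 := by
  have h0 : Hom.baseChange ℂ (0 : AK ⟶ Aμ) = 0 := by
    have h := AbelianVariety.Hom.baseChange_add ℂ (0 : AK ⟶ Aμ) 0
    rw [add_zero] at h
    exact add_eq_left.1 h.symm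
  rw [pull_comp, h0, pull_zero_one, LinearMap.comp_zero]

/-- **Functoriality of `f ↦ (j ≫ f_ℂ)^*` in `f`** — the shape of S2's `phiStarQ_comp` and of the `M_μ`-linearity law `P_smul` (Def. 4.16:
«`M_μ` acts via `i_μ`», i.e. by POST-composition with `i_μ(m) : A_μ → A_μ`): `(j ≫ (f ≫ g)_ℂ)^* = (j ≫ f_ℂ)^* ∘ g_ℂ^*`.
[cite: Liu2021, Def. 4.16 (l. 2219) and proof of Thm. 4.18 (l. 2247–2253)] -/
theorem pull_comp_baseChange_comp (j : P ⟶ (AK.baseChange ℂ).X) (f : AK ⟶ Aμ) (g : Aμ ⟶ Aν) (k : ℕ) :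
    pull (j ≫ (Hom.baseChange ℂ (f ≫ g)).hom.hom.hom) k =
      pull (j ≫ (Hom.baseChange ℂ f).hom.hom.hom) k ∘ₗ pull (Hom.baseChange ℂ g).hom.hom.hom k := by
  rw [AbelianVariety.Hom.baseChange_comp, pull_comp, pull_comp, pull_comp_hom, LinearMap.comp_assoc]

/-- **Functoriality in the source** (transition maps of the tower `{A_K}_K`, l. 2070: `Alb_{u^{K'}_K} : A_{K'} → A_K`; the shape of S2's
`phiStarQ_comp` for `φ ↦ Alb_u ≫ φ`): `(j' ≫ (t ≫ f)_ℂ)^* = (j' ≫ t_ℂ)^* ∘ … ` read as `pull` along `j' ≫ t_ℂ` then `f_ℂ`.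
[cite: Liu2021, §4.2 l. 2070–2072 and proof of Thm. 4.18 (l. 2247–2253)] -/
theorem pull_comp_baseChange_comp' {AK' : AbelianVariety E} (j' : P ⟶ (AK'.baseChange ℂ).X) (t : AK' ⟶ AK) (f : AK ⟶ Aμ) (k : ℕ) :
    pull (j' ≫ (Hom.baseChange ℂ (t ≫ f)).hom.hom.hom) k =
      pull ((j' ≫ (Hom.baseChange ℂ t).hom.hom.hom) ≫ (Hom.baseChange ℂ f).hom.hom.hom) k := by
  rw [AbelianVariety.Hom.baseChange_comp, Category.assoc]
  rfl

/-- **`[n]_ℂ^* = n` on `H¹(A_ℂ(ℂ); ℚ)`**: the complexification of multiplication by `n : ℕ` on `A` acts as `n` on `H¹` (so clearing the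
denominator of `φ ∈ ℚ ⊗ Hom` by `[N]` multiplies the class by `N` — the bookkeeping behind S4's rescaled records `d_q`).
[cite: GortzWedhorn2020, Remark 16.54] -/
theorem pull_baseChange_nsmul_id (n : ℕ) :
    pull (Hom.baseChange ℂ (n • 𝟙 AK : AK ⟶ AK)).hom.hom.hom 1 = n • LinearMap.id := by
  have h : Hom.baseChange ℂ (n • 𝟙 AK : AK ⟶ AK) = n • 𝟙 (AK.baseChange ℂ) := by
    have := AbelianVariety.baseChange_zsmul_id ℂ AK (n : ℤ)
    simpa only [natCast_zsmul] using this
  rw [h, pull_nsmul_id_one]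

end BaseChange

end Summit.HodgeConjecture.CorCM.D2Bridge

end
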